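import Literature.IUT.HodgeArakelov.MonoThetaFromGroups
import Literature.IUT.HodgeArakelov.Prop13ToyModel
import HarnessLib

/-!
# [IUTchII] §1 Prop. 1.2 (i): the universal closure of `Prop12_i_indeterminacy` (F-0663) DECIDED (proof-only)

S. Mochizuki, *Inter-universal Teichmüller theory II*, §1, Proposition 1.2 (i), kurims manuscript (Dec. 2020) p. 25
[claim: Mochizuki2012, status: disputed] (IUTchII §1 Prop 1.2 (i), kurims p.25): «the isomorphism indeterminacy of
`M^Θ(Π)` is with respect to a group of `μ_N`-conjugacy classes of automorphisms which is of order `1` (respectively, `2`)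
if `N` is odd (respectively, even) [cf. [EtTh], Corollary 2.18, (iv)]». abc-iut cell, seat abc-iut-f-109 (gen 9), FACT-LIST
row **F-0663** `Prop12_i_indeterminacy` (abc-iut-L6-t1, `MonoThetaFromGroups.lean`, FROZEN; tagged «[EtTh] Prop1.2(i)» in
the list — a tag erratum, the item is [IUTchII] §1 Prop. 1.2 (i); director-abc g4 sheet ROWS-LF-0348). PROOF-ONLY companion:
no `def`, no `structure`, no `instance`, nothing re-typed; the typed predicate and abc-iut-f-185's CLOSED junk Def. 1.1 (i)
output `Prop13Toy.recon` (`Prop13ToyModel.lean`) are consumed BY NAME.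

* `Prop13Toy.not_prop12_i_indeterminacy` — at the toy (`N := 3`, `Π := Ẑ × μ_3`, `D_Π := Inn`, `s^Θ := ∅`,
  `Π_Y := Ẑ` by the first projection) the typed predicate FAILS: `N` is odd, so it asks for exactly ONE
  `μ_N`-conjugacy class of automorphisms of `M` acting trivially on `Π_Y(M)`; but the identity and
  `id × (x ↦ x⁻¹ on μ_3)` are two isomorphisms `M ≅ M` ([EtTh] Def. 2.13 (ii): bi-continuous, `D ↦ D` because an
  automorphism normalises `Inn`, `∅ ↦ ∅`) over `Π_Y`, and they are not `μ_3`-conjugate, `Π` being the product of two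
  abelian groups on which `Π_μ = 1 × μ_3` conjugates trivially.
* `not_forall_prop12_i_indeterminacy` — hence the universal closure over all `(S, M, R)` is FALSE.

FACT-LIST currency (R5): F-0663 → «universal closure REFUTED / schema; instance forms are the content» — instance forms BY
NAME, untouched: `ModelTateCarriers.prop12_i_indeterminacy_envOfGroup_modelTate` (p453435, genuine [IUTchII] §1 carrier of the
Tate curve), `ThetaSetting.prop12_i_indeterminacy_envOfGroup_ofDoubleUnderline_modelχ` (p439934),
`prop12_i_indeterminacy_of_modelIso` / `prop12_i_indeterminacy_reconstruction` (p412174),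
`prop12_i_indeterminacy_of_ker_eq_centralizerUnion` (p412730). HONEST FRAMING: a refuted universal closure is a statement
about OUR typing (the interfaces `ThetaSetting` / `MonoThetaEnv` / `Reconstruction` admit junk data — no curve, `Δ = 1`,
empty theta section), not a finding against print, which asserts (i) for the GENUINE `M^Θ(Π)` only; [IUTchII] §1 Prop. 1.2
lies OUTSIDE the [IUTchIII] Cor. 3.12 cone; the claim key `Mochizuki2012` is DISPUTED (D-0012) and nothing of it is asserted;
no side is taken on Cor. 3.12 or on any author; typed ≠ proved; instantiated ≠ endorsed; nothing here asserts abc proved or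
refuted. Elementary group theory over Mathlib (`MulEquiv.prodCongr`, `MulEquiv.inv`, `ZMod 3`).
-/

noncomputable section

namespace Literature.IUT.HodgeArakelov

open Topology

/-- An automorphism `e` of a group normalises the inner automorphisms: transporting `Inn(G)` along
`MulAut.congr e` gives `Inn(G)` back (`e ∘ conj(g) ∘ e⁻¹ = conj(e g)`). [folklore] -/
private theorem map_congr_range_conj {G : Type*} [Group G] (e : G ≃* G) :
    ((MulAut.conj : G →* MulAut G).range).map (MulAut.congr e).toMonoidHom =
      (MulAut.conj : G →* MulAut G).range := by
  ext φ
  constructor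
  · rintro ⟨ψ, ⟨g, rfl⟩, rfl⟩
    refine ⟨e g, ?_⟩
    ext x
    simp [MulAut.congr, MulAut.conj_apply]
  · rintro ⟨g, rfl⟩
    refine ⟨MulAut.conj (e.symm g), ⟨e.symm g, rfl⟩, ?_⟩
    ext x
    simp [MulAut.congr, MulAut.conj_apply]

namespace Prop13Toy

/-- **F-0663 at abc-iut-f-185's toy: `Prop12_i_indeterminacy` FAILS.** With `N = 3` odd the typed Prop. 1.2 (i)
predicate asks for exactly one `μ_N`-conjugacy class of automorphisms of the toy mono-theta environment
(`Π = Ẑ × μ_3`, `D = Inn`, `s^Θ = ∅`) acting trivially on `Π_Y = Ẑ`; the identity and `id × (·)⁻¹` are two such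
automorphisms that are not `μ_3`-conjugate. JUNK DATA by design.
[claim: Mochizuki2012, status: disputed] (IUTchII §1 Prop 1.2 (i), kurims p.25) -/
theorem not_prop12_i_indeterminacy : ¬ Prop12_i_indeterminacy recon := by
  -- the flip `(z, m) ↦ (z, m⁻¹)` as an isomorphism of mono-theta environments `mte ≅ mte`
  let e : P ≃* P := MulEquiv.prodCongr (MulEquiv.refl Zh) (MulEquiv.inv Mu)
  have he : ∀ x : P, e x = (x.1, x.2⁻¹) := fun _ => rfl
  have hes : ∀ x : P, e.symm x = (x.1, x.2⁻¹) := fun _ => rfl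
  have hcont : Continuous e := by
    have h : (e : P → P) = fun x => (x.1, x.2⁻¹) := funext he
    rw [h]
    exact continuous_fst.prodMk continuous_snd.inv
  have hcont' : Continuous e.symm := by
    have h : (e.symm : P → P) = fun x => (x.1, x.2⁻¹) := funext hes
    rw [h]
    exact continuous_fst.prodMk continuous_snd.inv
  let ec : P ≃ₜ* P := { e with continuous_toFun := hcont, continuous_invFun := hcont' }
  let flip : MonoThetaEnv.Iso mte mte :=
    { iso := ec
      map_D := map_congr_range_conj e
      map_theta := Set.image_empty _ }
  let idI : MonoThetaEnv.Iso mte mte :=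
    { iso := ContinuousMulEquiv.refl P
      map_D := map_congr_range_conj (MulEquiv.refl P)
      map_theta := Set.image_empty _ }
  rintro ⟨T, hcard, -, huniq⟩
  -- `N = 3` is odd: `T = {τ}`
  have hodd : Odd ((setting.N : ℕ+) : ℕ) := by decide
  rw [if_pos hodd] at hcard
  obtain ⟨τ, rfl⟩ := Finset.card_eq_one.mp hcard
  -- both `idI` and `flip` act trivially on `Π_Y = Ẑ` (first projection)
  obtain ⟨τ₁, ⟨hτ₁, m₁, hm₁⟩, -⟩ := huniq idI fun _ => rfl
  obtain ⟨τ₂, ⟨hτ₂, m₂, hm₂⟩, -⟩ := huniq flip fun _ => rfl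
  rw [Finset.mem_singleton] at hτ₁ hτ₂
  subst hτ₁
  subst hτ₂
  -- compare second components at `x₀ = (1, ζ)`, `ζ = ofAdd 1 ∈ μ_3`: conjugation by `Π_μ` is trivial on `μ_3`
  have h₁ := congrArg Prod.snd (hm₁ ((1 : Zh), Multiplicative.ofAdd (1 : ZMod 3)))
  have h₂ := congrArg Prod.snd (hm₂ ((1 : Zh), Multiplicative.ofAdd (1 : ZMod 3)))
  have hc : ∀ (m : (recon).extCyc) (y : P), (((m : P) * y * (m : P)⁻¹).2) = y.2 := fun m y => by
    rw [Prod.snd_mul, Prod.snd_mul, Prod.snd_inv, mul_comm (m : P).2 y.2, mul_inv_cancel_right]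
  rw [hc] at h₁ h₂
  -- `h₁ : ζ = (τ ζ).2`, `h₂ : ζ⁻¹ = (τ ζ).2`
  have h12 : Multiplicative.ofAdd (1 : ZMod 3) = (Multiplicative.ofAdd (1 : ZMod 3))⁻¹ := by
    change (idI.iso ((1 : Zh), Multiplicative.ofAdd (1 : ZMod 3))).2 = _ at h₁
    change (flip.iso ((1 : Zh), Multiplicative.ofAdd (1 : ZMod 3))).2 = _ at h₂
    exact (h₁.trans h₂.symm)
  exact absurd h12 (by decide)

end Prop13Toy

/-- **F-0663 universal closure REFUTED (schema).** The typed [IUTchII] §1 Prop. 1.2 (i) predicate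
`Prop12_i_indeterminacy` does not hold for every Def. 1.1 (i) output of every mono-theta environment of every
`ThetaSetting`: it fails at abc-iut-f-185's closed toy `Prop13Toy.recon`. The instance forms at the genuine
carriers (`ModelTateCarriers.prop12_i_indeterminacy_envOfGroup_modelTate`, …) are the content of the row.
[claim: Mochizuki2012, status: disputed] (IUTchII §1 Prop 1.2 (i), kurims p.25) -/
theorem not_forall_prop12_i_indeterminacy :
    ¬ ∀ (S : ThetaSetting.{0}) (M : MonoThetaEnv S) (R : Reconstruction M),
      Literature.IUT.HodgeArakelov.Prop12_i_indeterminacy R :=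
  fun h => Prop13Toy.not_prop12_i_indeterminacy (h _ _ _)

end Literature.IUT.HodgeArakelov
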